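import Literature.Computability.Complexity.FKPointLocationProtocol
import HarnessLib

/-!
# Fournier–Koiran point location, VIII: the untyped mirror of the protocol

Topic `Literature/Computability/Complexity`, grouping namespace `FKPointLocation`. The oracle
machine of Theorem 3 is ONE machine for all input dimensions `n`, so its state cannot be the
dimension-indexed `Data Q.D` of `FKPointLocationProtocol.lean` (vectors `Fin D → ℤ`, tasks indexed
by `Fin D`): this file transcribes the protocol to dimension-free data (`UTask`, `UScratch`,
`UData`: lists of integers, natural-number indices, the level parameters as a plain record
`UParams`) — `uupd`, `ufinishLevel`, the queried form `uqueryForm` (`ulocalForm`, `uliftForm`,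
`uliftAll`), the schedule `uagenda` — and proves that the transcription COMMUTES with the typed
protocol along `Data.toU` (`toU_upd`, `toU_queryForm`, `toU_init`, `map_toU_agenda`). The
polynomial-time realisation (`CodeFP`) is then carried out on the untyped side only.

## References

* H. Fournier, P. Koiran, *Lower bounds are not easier over the reals: inside PH*, ICALP 2000,
  LNCS 1853 = LIP RR-1999-21, §2.1 (Steps 1 and k), Thm 3. [FournierKoiran2000]
-/

namespace Literature.Computability.Complexity

namespace FKPointLocation

open Classical

/-! ### Vectors as lists -/

section Vec

variable {α : Type} {D : ℕ}

/-- Reading a list with default `0`. [folklore] -/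
def vget (l : List ℤ) (i : ℕ) : ℤ := l.getD i 0

/-- A list of the right length whose entries are those of `f` is `List.ofFn f`. [folklore] -/
theorem ofFn_eq_of_getElem {f : Fin D → α} {l : List α} (hl : l.length = D)
    (h : ∀ (i : ℕ) (hi : i < D), l[i]'(by omega) = f ⟨i, hi⟩) : List.ofFn f = l := by
  apply List.ext_getElem (by simp [hl])
  intro i h₁ h₂
  rw [List.getElem_ofFn]
  exact (h i (by simpa using h₁)).symm

/-- `ofFn` of an update is `set`. [folklore] -/
theorem ofFn_update [DecidableEq (Fin D)] (f : Fin D → α) (i : Fin D) (v : α) :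
    List.ofFn (Function.update f i v) = (List.ofFn f).set i.val v := by
  refine ofFn_eq_of_getElem (by simp) fun j hj => ?_
  rw [List.getElem_set]
  by_cases h : i.val = j
  · subst h; simp
  · rw [if_neg h, List.getElem_ofFn, Function.update_of_ne]
    exact fun he => h (by rw [← he])

/-- `ofFn` of the zero vector. [folklore] -/
theorem ofFn_zero {β : Type} [Zero β] : List.ofFn (0 : Fin D → β) = List.replicate D 0 :=
  List.ofFn_const D (0 : β)

/-- `ofFn` of a one-hot vector. [folklore] -/
theorem ofFn_oneHot (i : Fin D) (c z : α) :
    List.ofFn (fun i' => if i' = i then c else z) = (List.replicate D z).set i.val c := by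
  refine ofFn_eq_of_getElem (by simp) fun j hj => ?_
  rw [List.getElem_set]
  by_cases h : i.val = j
  · subst h; simp
  · rw [if_neg h, List.getElem_replicate, if_neg]
    exact fun he => h (by rw [← he])

/-- Reading `ofFn`. [folklore] -/
theorem getD_ofFn (f : Fin D → α) (i : Fin D) (d : α) : (List.ofFn f).getD i.val d = f i := by
  rw [List.getD_eq_getElem _ _ (by simp), List.getElem_ofFn]

/-- `vget` of `ofFn`. [folklore] -/
@[simp] theorem vget_ofFn (f : Fin D → ℤ) (i : Fin D) : vget (List.ofFn f) i.val = f i := getD_ofFn f i 0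

/-- Dot product of lists. [folklore] -/
def udot (l₁ l₂ : List ℤ) : ℤ := (List.zipWith (· * ·) l₁ l₂).sum

/-- `zipWith` of two `ofFn`. [folklore] -/
theorem zipWith_ofFn {β γ : Type} (g : α → β → γ) (f₁ : Fin D → α) (f₂ : Fin D → β) :
    List.zipWith g (List.ofFn f₁) (List.ofFn f₂) = List.ofFn fun i => g (f₁ i) (f₂ i) := by
  symm
  refine ofFn_eq_of_getElem (by simp) fun j hj => ?_
  simp [List.getElem_zipWith]

/-- The dot product of `ofFn` lists is the finite sum. [folklore] -/
theorem udot_ofFn (f₁ f₂ : Fin D → ℤ) : udot (List.ofFn f₁) (List.ofFn f₂) = ∑ i, f₁ i * f₂ i := by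
  rw [udot, zipWith_ofFn, List.sum_ofFn]

/-- Pointwise map of `ofFn`. [folklore] -/
theorem map_ofFn' {β : Type} (g : α → β) (f : Fin D → α) : (List.ofFn f).map g = List.ofFn (g ∘ f) := by
  rw [List.map_ofFn]

end Vec

/-! ### Untyped tasks and data -/

/-- Dimension-free tasks. [cite: FournierKoiran2000, §2.1] -/
inductive UTask : Type
  | bs (i k : ℕ)
  | ex (sc m : ℕ)
  | pf (sc m w : ℕ)
  | st (sc : ℕ)
  | ap (w : ℕ)
  | eqGe (i : ℕ)
  | eqLe (i : ℕ)
  | fa (i : ℕ)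
  | close
  | fin
  deriving DecidableEq, Inhabited

/-- Forgetting the dimension of a task. [folklore] -/
def Task.toU {D : ℕ} : Task D → UTask
  | Task.bs i k => UTask.bs i.val k
  | Task.ex sc m => UTask.ex sc m
  | Task.pf sc m w => UTask.pf sc m w
  | Task.st sc => UTask.st sc
  | Task.ap w => UTask.ap w
  | Task.eqGe i => UTask.eqGe i.val
  | Task.eqLe i => UTask.eqLe i.val
  | Task.fa i => UTask.fa i.val
  | Task.close => UTask.close
  | Task.fin => UTask.fin

/-- Sign tasks, untyped. [folklore] -/
def UTask.isSign : UTask → Bool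
  | bs _ _ => true
  | eqGe _ => true
  | eqLe _ => true
  | fa _ => true
  | close => true
  | _ => false

/-- `isSign` is preserved. [folklore] -/
@[simp] theorem Task.isSign_toU {D : ℕ} (τ : Task D) : τ.toU.isSign = τ.isSign := by
  cases τ <;> rfl

/-- Dimension-free level record. [folklore] -/
structure ULevelRec : Type where
  m : List ℤ
  sc : ℕ
  apexN : List ℤ
  apexD : ℕ
  istar : ℕ
  εstar : ℤ
  deriving DecidableEq, Inhabited

/-- Dimension-free scratch. [folklore] -/
@[ext] structure UScratch : Type where
  m : List ℤ
  bsAcc : ℕ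
  chain : List (List ℤ)
  exOk : Bool
  bits : List Bool
  stable : Option (ℕ × List (List ℤ))
  apexN : List ℤ
  apexD : ℕ
  ge : List Bool
  le : List Bool
  cand : Option ℕ
  deriving Inhabited

/-- Dimension-free state. [folklore] -/
@[ext] structure UData : Type where
  done : Bool
  out : Bool
  chart : List ℤ
  levels : List ULevelRec
  cur : UScratch
  deriving Inhabited

/-- The level parameters as plain numbers (`bB = size B`, `Wf`, `Wa` precomputed). [folklore] -/
structure UParams : Type where
  D : ℕ
  L : ℕ
  κ : ℕ
  W : ℕ
  bB : ℕ
  Wf : ℕ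
  Wa : ℕ
  deriving DecidableEq, Inhabited

/-- The plain parameters of `Q`. [folklore] -/
def _root_.Literature.Computability.Complexity.FKPointLocation.LevelParams.toU (Q : LevelParams) : UParams :=
  ⟨Q.D, Q.L, Q.κ, Q.W, Q.bB, Q.Wf, Q.Wa⟩

section ToU

variable {D : ℕ}

/-- Forgetting the dimension of a level record. [folklore] -/
def LevelRec.toU (r : LevelRec D) : ULevelRec :=
  ⟨List.ofFn r.m, r.sc, List.ofFn r.apex.1, r.apex.2, r.istar.val, r.εstar⟩

/-- Forgetting the dimension of a scratch. [folklore] -/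
def Scratch.toU (c : Scratch D) : UScratch :=
  ⟨List.ofFn c.m, c.bsAcc, c.chain.map List.ofFn, c.exOk, c.bits,
    c.stable.map fun p => (p.1, p.2.map List.ofFn), List.ofFn c.apex.1, c.apex.2,
    List.ofFn c.ge, List.ofFn c.le, c.cand.map Fin.val⟩

/-- Forgetting the dimension of a state. [folklore] -/
def Data.toU (dat : Data D) : UData :=
  ⟨dat.done, dat.out, List.ofFn dat.chart, dat.levels.map LevelRec.toU, dat.cur.toU⟩

end ToU

/-! ### Untyped codes of forms and apexes -/

/-- `decodeForm` as a list. [folklore] -/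
def udecodeForm (b D : ℕ) (w : List Bool) : List ℤ :=
  (List.range D).map fun i => chunkInt ((w.drop (i * (b + 1))).take (b + 1))

/-- `decodeApex` as lists. [folklore] -/
def udecodeApex (W D : ℕ) (w : List Bool) : List ℤ × ℕ :=
  (udecodeForm W D (w.drop W), bitsToNat (w.take W))

/-- `ofFn ∘ decodeForm = udecodeForm`. [folklore] -/
theorem ofFn_decodeForm (b D : ℕ) (w : List Bool) : List.ofFn (decodeForm b D w) = udecodeForm b D w := by
  refine ofFn_eq_of_getElem (by simp [udecodeForm]) fun j hj => ?_
  simp [udecodeForm, decodeForm]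

/-- `decodeApex` commutes. [folklore] -/
theorem toU_decodeApex (W D : ℕ) (w : List Bool) :
    (List.ofFn (decodeApex W D w).1, (decodeApex W D w).2) = udecodeApex W D w := by
  simp only [udecodeApex, decodeApex, Prod.mk.injEq, and_true]
  exact ofFn_decodeForm W D (w.drop W)

/-! ### The untyped transition -/

/-- `signOf` read from answer lists. [folklore] -/
def usignAt (ge le : List Bool) (i : ℕ) : ℤ := signOf (ge.getD i false) (le.getD i false)

/-- `validB`, untyped. [folklore] -/
def UData.validB (dat : UData) (i : ℕ) : Bool :=
  decide (vget dat.chart i = 0) && decide (usignAt dat.cur.ge dat.cur.le i ≠ 0)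

/-- Fresh untyped scratch in dimension `D`. [folklore] -/
def UScratch.init (D : ℕ) : UScratch :=
  ⟨List.replicate D 0, 0, [], false, [], none, List.replicate D 0, 1, List.replicate D false, List.replicate D false, none⟩

/-- The untyped initial state. [folklore] -/
def UData.init (D : ℕ) : UData := ⟨false, false, List.replicate D 0, [], UScratch.init D⟩

/-- `closeRec`, untyped. [folklore] -/
def ucloseRec (c : UScratch) (istar : ℕ) (ε : ℤ) : ULevelRec :=
  ⟨c.m, (c.stable.map Prod.fst).getD 0, c.apexN, c.apexD, istar, ε⟩

/-- `finishLevel`, untyped. [cite: FournierKoiran2000, §2.1] -/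
def ufinishLevel (P : UParams) (dat : UData) : UData :=
  match dat.cur.cand with
  | none => { dat with done := true, levels := ucloseRec dat.cur 0 1 :: dat.levels, cur := UScratch.init P.D }
  | some c =>
    { dat with chart := dat.chart.set c (if dat.cur.ge.getD c false then 1 else -1),
               levels := ucloseRec dat.cur c (if dat.cur.ge.getD c false then 1 else -1) :: dat.levels,
               cur := UScratch.init P.D }

/-- The new stable pair after a stability answer `b` at scale `sc` (a named function, so that no
statement elsewhere has to restate a `match`). [folklore] -/
def stableUpd (st : Option (ℕ × List (List ℤ))) (b : Bool) (sc : ℕ) (chain : List (List ℤ)) : Option (ℕ × List (List ℤ)) :=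
  match st with
  | some p => some p
  | none => if b then none else some (sc, chain)

/-- The new facet candidate after comparing with `i` (`v` = `i` is valid, `b` = the answer). [folklore] -/
def candUpd (cand : Option ℕ) (v b : Bool) (i : ℕ) : Option ℕ :=
  match cand with
  | none => if v then some i else none
  | some c => if v && !b then some i else some c

/-- `stableUpd` on constructors. [folklore] -/
@[simp] theorem stableUpd_some (p : ℕ × List (List ℤ)) (b : Bool) (sc : ℕ) (ch : List (List ℤ)) : stableUpd (some p) b sc ch = some p := rfl
/-- `stableUpd` on `none`. [folklore] -/
@[simp] theorem stableUpd_none (b : Bool) (sc : ℕ) (ch : List (List ℤ)) : stableUpd none b sc ch = if b then none else some (sc, ch) := rfl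
/-- `candUpd` on constructors. [folklore] -/
@[simp] theorem candUpd_none (v b : Bool) (i : ℕ) : candUpd none v b i = if v then some i else none := rfl
/-- `candUpd` on `some`. [folklore] -/
@[simp] theorem candUpd_some (c : ℕ) (v b : Bool) (i : ℕ) : candUpd (some c) v b i = if v && !b then some i else some c := rfl

/-- **The untyped transition.** [cite: FournierKoiran2000, §2.1 Steps 1 and k] -/
def uupd (P : UParams) (dat : UData) (τ : UTask) (b : Bool) : UData :=
  if dat.done then dat else
  match τ with
  | UTask.bs i k =>
    if vget dat.chart i ≠ 0 then
      (if k = P.L then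
        { dat with cur := { dat.cur with m := dat.cur.m.set i (vget dat.chart i * 2 ^ (P.L + 1)), bsAcc := 0 } }
       else dat)
    else
      let acc := if k = 0 then 0 else dat.cur.bsAcc
      let acc' := 2 * acc + b.toNat
      if k = P.L then
        { dat with cur := { dat.cur with m := dat.cur.m.set i (2 * (acc' : ℤ) + 1 - 2 ^ (P.L + 1)), bsAcc := 0 } }
      else { dat with cur := { dat.cur with bsAcc := acc' } }
  | UTask.ex _ _ => { dat with cur := { dat.cur with exOk := b, bits := [] } }
  | UTask.pf _ _ w =>
    if dat.cur.exOk then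
      let bits' := dat.cur.bits ++ [b]
      if w + 1 = P.Wf then
        { dat with cur := { dat.cur with chain := dat.cur.chain ++ [udecodeForm P.bB P.D bits'], bits := [], exOk := false } }
      else { dat with cur := { dat.cur with bits := bits' } }
    else dat
  | UTask.st sc =>
    { dat with cur := { dat.cur with stable := stableUpd dat.cur.stable b sc dat.cur.chain, chain := [], bits := [], exOk := false } }
  | UTask.ap w =>
    let bits' := dat.cur.bits ++ [b]
    if w + 1 = P.Wa then
      { dat with cur := { dat.cur with apexN := (udecodeApex P.W P.D bits').1, apexD := (udecodeApex P.W P.D bits').2, bits := [] } }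
    else { dat with cur := { dat.cur with bits := bits' } }
  | UTask.eqGe i => { dat with cur := { dat.cur with ge := dat.cur.ge.set i b } }
  | UTask.eqLe i => { dat with cur := { dat.cur with le := dat.cur.le.set i b } }
  | UTask.fa i => { dat with cur := { dat.cur with cand := candUpd dat.cur.cand (dat.validB i) b i } }
  | UTask.close => ufinishLevel P dat
  | UTask.fin => { dat with out := b }

/-! ### Commuting with the typed protocol -/

section Commute

variable (Q : LevelParams)

/-- `toU` of the fresh scratch. [folklore] -/
theorem toU_scratchInit : (Scratch.init Q.D).toU = UScratch.init Q.D := by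
  simp only [Scratch.init, Scratch.toU, UScratch.init, List.map_nil, Option.map_none, List.ofFn_const, ofFn_zero]

/-- `toU` of the initial state. [folklore] -/
theorem toU_init : (Data.init Q.D).toU = UData.init Q.D := by
  simp only [Data.init, Data.toU, UData.init, List.map_nil, toU_scratchInit, ofFn_zero]

variable {Q}

/-- `validB` commutes. [folklore] -/
theorem toU_validB (dat : Data Q.D) (i : Fin Q.D) : dat.toU.validB i.val = dat.validB i := by
  simp [UData.validB, Data.validB, Data.toU, Scratch.toU, usignAt]

/-- `closeRec` commutes. [folklore] -/
theorem toU_closeRec (c : Scratch Q.D) (istar : Fin Q.D) (ε : ℤ) :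
    (closeRec Q c istar ε).toU = ucloseRec c.toU istar.val ε := by
  simp only [closeRec, LevelRec.toU, ucloseRec, Scratch.toU, Option.map_map]
  rfl

/-- `finishLevel` commutes. [cite: FournierKoiran2000, §2.1] -/
theorem toU_finishLevel (dat : Data Q.D) : (finishLevel Q dat).toU = ufinishLevel Q.toU dat.toU := by
  unfold finishLevel ufinishLevel
  have hc : dat.toU.cur.cand = dat.cur.cand.map Fin.val := rfl
  rcases h : dat.cur.cand with _ | c
  · rw [hc, h]
    simp only [Option.map_none]
    simp only [Data.toU, List.map_cons, toU_closeRec, toU_scratchInit]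
    rfl
  · rw [hc, h]
    simp only [Option.map_some]
    have hge : dat.cur.toU.ge.getD c.val false = dat.cur.ge c := getD_ofFn _ _ _
    simp only [Data.toU, List.map_cons, toU_closeRec, toU_scratchInit, ofFn_update, hge]
    rfl

/-- **The transition commutes with forgetting the dimension.**
[cite: FournierKoiran2000, §2.1 Steps 1 and k] -/
theorem toU_upd (dat : Data Q.D) (τ : Task Q.D) (b : Bool) :
    (upd Q dat τ b).toU = uupd Q.toU dat.toU τ.toU b := by
  have hdone : dat.toU.done = dat.done := rfl
  by_cases hd : dat.done
  · simp [upd, uupd, hd, hdone]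
  have hL : Q.toU.L = Q.L := rfl
  have hWf : Q.toU.Wf = Q.Wf := rfl
  have hWa : Q.toU.Wa = Q.Wa := rfl
  have hW : Q.toU.W = Q.W := rfl
  have hD : Q.toU.D = Q.D := rfl
  have hbB : Q.toU.bB = Q.bB := rfl
  cases τ with
  | bs i k =>
    have hci : vget dat.toU.chart i.val = dat.chart i := vget_ofFn _ _
    simp only [upd, uupd, hd, hdone, if_false, Task.toU, Bool.false_eq_true, hci, hL]
    by_cases hc : dat.chart i ≠ 0
    · rw [if_pos hc, if_pos hc]
      split_ifs <;> simp [Data.toU, Scratch.toU, ofFn_update]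
    · rw [if_neg hc, if_neg hc]
      have hacc : dat.toU.cur.bsAcc = dat.cur.bsAcc := rfl
      rw [hacc]
      split_ifs <;> simp [Data.toU, Scratch.toU, ofFn_update]
  | ex sc m => simp [upd, uupd, hd, Task.toU, Data.toU, Scratch.toU]
  | pf sc m w =>
    have hex : dat.toU.cur.exOk = dat.cur.exOk := rfl
    have hbits : dat.toU.cur.bits = dat.cur.bits := rfl
    simp only [upd, uupd, hd, hdone, if_false, Task.toU, Bool.false_eq_true, hex, hbits, hWf, hbB, hD]
    by_cases he : dat.cur.exOk = true
    · rw [if_pos he, if_pos he]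
      split_ifs <;> simp [Data.toU, Scratch.toU, ofFn_decodeForm]
    · rw [if_neg he, if_neg he]
  | st sc =>
    simp only [upd, uupd, hd, hdone, if_false, Task.toU, Bool.false_eq_true]
    have hst : dat.toU.cur.stable = dat.cur.stable.map fun p => (p.1, p.2.map List.ofFn) := rfl
    rw [hst]
    rcases hs : dat.cur.stable with _ | p
    · cases b <;> simp [Data.toU, Scratch.toU, hs, stableUpd]
    · simp [Data.toU, Scratch.toU, hs, stableUpd]
  | ap w =>
    have hbits : dat.toU.cur.bits = dat.cur.bits := rfl
    simp only [upd, uupd, hd, hdone, if_false, Task.toU, Bool.false_eq_true, hbits, hWa, hW, hD]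
    split_ifs
    · simp only [Data.toU, Scratch.toU, ← toU_decodeApex]
    · simp [Data.toU, Scratch.toU]
  | eqGe i => simp [upd, uupd, hd, Task.toU, Data.toU, Scratch.toU, ofFn_update]
  | eqLe i => simp [upd, uupd, hd, Task.toU, Data.toU, Scratch.toU, ofFn_update]
  | fa i =>
    have hv : dat.toU.validB i.val = dat.validB i := toU_validB dat i
    simp only [upd, uupd, hd, hdone, if_false, Task.toU, Bool.false_eq_true, hv]
    have hcd : dat.toU.cur.cand = dat.cur.cand.map Fin.val := rfl
    rw [hcd]
    rcases hc : dat.cur.cand with _ | c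
    · simp only [Option.map_none, candUpd_none]
      split_ifs <;> simp [Data.toU, Scratch.toU, hc]
    · simp only [Option.map_some, candUpd_some]
      split_ifs <;> simp [Data.toU, Scratch.toU, hc]
  | close =>
    simp only [upd, uupd, hd, hdone, if_false, Task.toU, Bool.false_eq_true]
    exact toU_finishLevel dat
  | fin => simp [upd, uupd, hd, Task.toU, Data.toU]

end Commute

/-! ### The queried form, untyped -/

/-- Untyped affine forms: coefficient list and constant. [folklore] -/
abbrev UAff : Type := List ℤ × ℤ

/-- Forgetting the dimension of a form. [folklore] -/
def affToU {D : ℕ} (φ : AffForm D) : UAff := (List.ofFn φ.1, φ.2)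

/-- One-hot list. [folklore] -/
def oneHot (D i : ℕ) (c : ℤ) : List ℤ := (List.replicate D 0).set i c

/-- `bsForm`, untyped. [cite: FournierKoiran2000, §2.1 Step 1] -/
def ubsForm (D i k acc : ℕ) : UAff := (oneHot D i (2 ^ k), 2 ^ k - 2 * acc - 1)

/-- `geForm`, untyped. [folklore] -/
def ugeForm (D : ℕ) (apexN : List ℤ) (apexD : ℕ) (i : ℕ) : UAff := (oneHot D i apexD, -vget apexN i)

/-- `leForm`, untyped. [folklore] -/
def uleForm (D : ℕ) (apexN : List ℤ) (apexD : ℕ) (i : ℕ) : UAff := (oneHot D i (-(apexD : ℤ)), vget apexN i)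

/-- `faForm`, untyped (two one-hot contributions added). [cite: FournierKoiran2000, §2.1] -/
def ufaForm (D : ℕ) (apexN : List ℤ) (apexD : ℕ) (εc εi : ℤ) (c i : ℕ) : UAff :=
  let d : ℤ := apexD
  let νc : ℤ := d - εc * vget apexN c
  let νi : ℤ := d - εi * vget apexN i
  (List.zipWith (· + ·) (oneHot D c (νi * εc * d)) (oneHot D i (-(νc * εi * d))),
    -(νi * εc * vget apexN c) + νc * εi * vget apexN i)

/-- Binary-search rounds within the depth `L` (the power `2^k` of the test is computed from a
unary budget). [folklore] -/
def UTask.KLe (L : ℕ) : UTask → Prop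
  | UTask.bs _ k => k ≤ L
  | _ => True

/-- `localForm`, untyped (the round of a binary-search task clamped to the depth `L`, which is
harmless on the schedule, `UTask.KLe`). [cite: FournierKoiran2000, §2.1] -/
def ulocalForm (P : UParams) (dat : UData) : UTask → UAff
  | UTask.bs i k => ubsForm P.D i (min k P.L) (if k = 0 then 0 else dat.cur.bsAcc)
  | UTask.eqGe i => ugeForm P.D dat.cur.apexN dat.cur.apexD i
  | UTask.eqLe i => uleForm P.D dat.cur.apexN dat.cur.apexD i
  | UTask.fa i =>
    match dat.cur.cand with
    | none => (List.replicate P.D 0, 0)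
    | some c => ufaForm P.D dat.cur.apexN dat.cur.apexD (usignAt dat.cur.ge dat.cur.le c) (usignAt dat.cur.ge dat.cur.le i) c i
  | _ => (List.replicate P.D 0, 0)

/-- Untyped apex record `(σ, d, i₀, ε)`. [folklore] -/
abbrev UApexRec : Type := List ℤ × ℕ × ℕ × ℤ

/-- Forgetting the dimension of an apex record. [folklore] -/
def ApexRec.toU {D : ℕ} (A : ApexRec D) : UApexRec := (List.ofFn A.σ, A.d, A.i₀.val, A.ε)

/-- `liftForm`, untyped. [cite: FournierKoiran2000, §2.1 Lemma 2] -/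
def uliftForm (A : UApexRec) (φ : UAff) : UAff :=
  let σ := A.1
  let d : ℤ := A.2.1
  let i₀ := A.2.2.1
  let ε := A.2.2.2
  let S : ℤ := udot φ.1 σ
  let Aσ : ℤ := S + φ.2 * d
  let E : ℤ := ε * d - vget σ i₀
  let τ : ℤ := E.sign
  ((List.range φ.1.length).map fun k => τ * (E * d * vget φ.1 k + if k = i₀ then Aσ * d else 0),
    τ * (-(Aσ * vget σ i₀) - E * S))

/-- `liftAll`, untyped. [cite: FournierKoiran2000, §2.1 Step k] -/
def uliftAll (hist : List UApexRec) (φ : UAff) : UAff := hist.foldl (fun ψ A => uliftForm A ψ) φ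

/-- The apex history of an untyped state. [folklore] -/
def UData.hist (dat : UData) : List UApexRec := dat.levels.map fun r => (r.apexN, r.apexD, r.istar, r.εstar)

/-- **The queried form, untyped.** [cite: FournierKoiran2000, §2.1 Step k] -/
def uqueryForm (P : UParams) (dat : UData) (τ : UTask) : UAff := uliftAll dat.hist (ulocalForm P dat τ)

section CommuteForms

variable {Q : LevelParams} {D : ℕ}

/-- One-hot vectors commute. [folklore] -/
theorem ofFn_oneHot_int (i : Fin D) (c : ℤ) : List.ofFn (fun i' => if i' = i then c else 0) = oneHot D i.val c :=
  ofFn_oneHot i c 0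

/-- `localForm` commutes (on tasks within the depth). [cite: FournierKoiran2000, §2.1] -/
theorem affToU_localForm (dat : Data Q.D) (τ : Task Q.D) (hτ : τ.toU.KLe Q.L) :
    affToU (localForm dat τ) = ulocalForm Q.toU dat.toU τ.toU := by
  have hD : Q.toU.D = Q.D := rfl
  have hL : Q.toU.L = Q.L := rfl
  cases τ with
  | bs i k =>
    have hk : min k Q.L = k := min_eq_left hτ
    simp only [localForm, ulocalForm, Task.toU, bsForm, ubsForm, affToU, hD, hL, hk, ofFn_oneHot_int]; rfl
  | eqGe i =>
    simp only [localForm, ulocalForm, Task.toU, geForm, ugeForm, affToU, hD, ofFn_oneHot_int]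
    simp [Data.toU, Scratch.toU]
  | eqLe i =>
    simp only [localForm, ulocalForm, Task.toU, leForm, uleForm, affToU, hD, ofFn_oneHot_int]
    simp [Data.toU, Scratch.toU]
  | fa i =>
    have hcd : dat.toU.cur.cand = dat.cur.cand.map Fin.val := rfl
    simp only [localForm, ulocalForm, Task.toU, hcd, hD]
    rcases hc : dat.cur.cand with _ | c
    · simp only [Option.map_none, affToU]; exact Prod.ext ofFn_zero rfl
    · simp only [Option.map_some, faForm, ufaForm, affToU]
      have hge : ∀ j : Fin Q.D, usignAt dat.toU.cur.ge dat.toU.cur.le j.val = signOf (dat.cur.ge j) (dat.cur.le j) := by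
        intro j; simp [usignAt, Data.toU, Scratch.toU]
      have hN : ∀ j : Fin Q.D, vget dat.toU.cur.apexN j.val = dat.cur.apex.1 j := fun j => vget_ofFn _ _
      have hd : dat.toU.cur.apexD = dat.cur.apex.2 := rfl
      rw [hge, hge, hN, hN, hd]
      refine Prod.ext ?_ rfl
      simp only
      rw [← ofFn_oneHot_int, ← ofFn_oneHot_int, zipWith_ofFn]
  | ex sc m => simp only [localForm, ulocalForm, Task.toU, affToU]; exact Prod.ext ofFn_zero rfl
  | pf sc m w => simp only [localForm, ulocalForm, Task.toU, affToU]; exact Prod.ext ofFn_zero rfl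
  | st sc => simp only [localForm, ulocalForm, Task.toU, affToU]; exact Prod.ext ofFn_zero rfl
  | ap w => simp only [localForm, ulocalForm, Task.toU, affToU]; exact Prod.ext ofFn_zero rfl
  | close => simp only [localForm, ulocalForm, Task.toU, affToU]; exact Prod.ext ofFn_zero rfl
  | fin => simp only [localForm, ulocalForm, Task.toU, affToU]; exact Prod.ext ofFn_zero rfl

/-- `liftForm` commutes. [cite: FournierKoiran2000, §2.1 Lemma 2] -/
theorem affToU_liftForm (A : ApexRec D) (φ : AffForm D) :
    affToU (liftForm A φ) = uliftForm A.toU (affToU φ) := by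
  simp only [liftForm, uliftForm, affToU, ApexRec.toU, udot_ofFn, vget_ofFn, List.length_ofFn]
  refine Prod.ext ?_ rfl
  refine ofFn_eq_of_getElem (by simp) fun j hj => ?_
  simp only [List.getElem_map, List.getElem_range]
  have : vget (List.ofFn φ.1) j = φ.1 ⟨j, hj⟩ := vget_ofFn φ.1 ⟨j, hj⟩
  rw [this]
  congr 2
  by_cases h : (⟨j, hj⟩ : Fin D) = A.i₀
  · rw [if_pos h, if_pos (by rw [← h])]
  · rw [if_neg h, if_neg (fun he => h (Fin.ext he))]

/-- `liftAll` commutes. [cite: FournierKoiran2000, §2.1 Step k] -/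
theorem affToU_liftAll (hist : List (ApexRec D)) (φ : AffForm D) :
    affToU (liftAll hist φ) = uliftAll (hist.map ApexRec.toU) (affToU φ) := by
  induction hist generalizing φ with
  | nil => rfl
  | cons A hist ih =>
    rw [liftAll_cons, ih, affToU_liftForm]; rfl

/-- The history commutes. [folklore] -/
theorem toU_hist (dat : Data Q.D) : dat.toU.hist = dat.hist.map ApexRec.toU := by
  simp [UData.hist, Data.hist, Data.toU, LevelRec.toU, ApexRec.toU, List.map_map, Function.comp_def]

/-- **The queried form commutes with forgetting the dimension** (on tasks within the depth).
[cite: FournierKoiran2000, §2.1 Step k] -/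
theorem toU_queryForm (dat : Data Q.D) (τ : Task Q.D) (hτ : τ.toU.KLe Q.L) :
    affToU (queryForm dat τ) = uqueryForm Q.toU dat.toU τ.toU := by
  rw [queryForm, uqueryForm, affToU_liftAll, toU_hist, affToU_localForm dat τ hτ]

end CommuteForms

/-! ### The schedule, untyped -/

/-- `levelTasks`, untyped. [cite: FournierKoiran2000, §2.1] -/
def ulevelTasks (P : UParams) (j : ℕ) : List UTask :=
  (if j = 0 then [] else
    ((List.range P.D).flatMap fun i => (List.range (P.L + 1)).map (UTask.bs i)) ++
    ((List.range (P.D + 1)).flatMap fun sc =>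
      ((List.range (P.D + 1)).flatMap fun m =>
        UTask.ex sc m :: (List.range P.Wf).map (UTask.pf sc m)) ++ [UTask.st sc]) ++
    (List.range P.Wa).map UTask.ap) ++
  ((List.range P.D).flatMap fun i => [UTask.eqGe i, UTask.eqLe i]) ++
  (List.range P.D).map UTask.fa ++ [UTask.close]

/-- `agenda`, untyped. [cite: FournierKoiran2000, §2.1, Thm 3] -/
def uagenda (P : UParams) : List UTask := (List.range (P.D + 1)).flatMap (ulevelTasks P)

section CommuteAgenda

variable (Q : LevelParams)

/-- `finRange` mapped through `Fin.val`-indexed constructors is `range`. [folklore] -/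
theorem map_finRange_val {α : Type} (D : ℕ) (g : ℕ → α) :
    (List.finRange D).map (fun i => g i.val) = (List.range D).map g := by
  rw [← List.map_coe_finRange_eq_range, List.map_map]; rfl

/-- `flatMap` over `finRange` through `Fin.val` is `flatMap` over `range`. [folklore] -/
theorem flatMap_finRange_val {α : Type} (D : ℕ) (g : ℕ → List α) :
    (List.finRange D).flatMap (fun i => g i.val) = (List.range D).flatMap g := by
  rw [← List.map_coe_finRange_eq_range, List.flatMap_map]

/-- `levelTasks` commutes. [folklore] -/
theorem map_toU_levelTasks (j : ℕ) : (levelTasks Q j).map Task.toU = ulevelTasks Q.toU j := by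
  have hD : Q.toU.D = Q.D := rfl
  have hL : Q.toU.L = Q.L := rfl
  have hWf : Q.toU.Wf = Q.Wf := rfl
  have hWa : Q.toU.Wa = Q.Wa := rfl
  have h1 : ((List.finRange Q.D).flatMap fun i => (List.range (Q.L + 1)).map (Task.bs i)).map Task.toU =
      (List.range Q.D).flatMap fun i => (List.range (Q.L + 1)).map (UTask.bs i) := by
    rw [List.map_flatMap]
    simp only [List.map_map, Function.comp_def, Task.toU]
    exact flatMap_finRange_val Q.D (fun i => (List.range (Q.L + 1)).map (UTask.bs i))
  have h2 : ((List.finRange Q.D).flatMap fun i => [Task.eqGe i, Task.eqLe i]).map Task.toU =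
      (List.range Q.D).flatMap fun i => [UTask.eqGe i, UTask.eqLe i] := by
    rw [List.map_flatMap]
    simp only [List.map_cons, List.map_nil, Task.toU]
    exact flatMap_finRange_val Q.D (fun i => [UTask.eqGe i, UTask.eqLe i])
  have h3 : ((List.finRange Q.D).map Task.fa).map Task.toU = (List.range Q.D).map UTask.fa := by
    rw [List.map_map]
    simp only [Function.comp_def, Task.toU]
    exact map_finRange_val Q.D UTask.fa
  have h4 : ((List.range (Q.D + 1)).flatMap fun sc =>
      ((List.range (Q.D + 1)).flatMap fun m => (Task.ex sc m : Task Q.D) :: (List.range Q.Wf).map (Task.pf sc m)) ++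
        [Task.st sc]).map Task.toU =
      (List.range (Q.D + 1)).flatMap fun sc =>
        ((List.range (Q.D + 1)).flatMap fun m => UTask.ex sc m :: (List.range Q.Wf).map (UTask.pf sc m)) ++ [UTask.st sc] := by
    rw [List.map_flatMap]
    simp only [List.map_append, List.map_flatMap, List.map_cons, List.map_map, Function.comp_def, Task.toU, List.map_nil]
  have h5 : ((List.range Q.Wa).map Task.ap).map (Task.toU (D := Q.D)) = (List.range Q.Wa).map UTask.ap := by
    rw [List.map_map]; simp only [Function.comp_def, Task.toU]
  unfold levelTasks ulevelTasks
  rw [hD, hL, hWf, hWa]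
  simp only [List.map_append, h2, h3, List.map_cons, List.map_nil, Task.toU]
  split_ifs with hj
  · rfl
  · rw [List.map_append, List.map_append, h1, h4, h5]

/-- **The schedule commutes.** [folklore] -/
theorem map_toU_agenda : (agenda Q).map Task.toU = uagenda Q.toU := by
  simp only [agenda, uagenda, List.map_flatMap]
  have hD : Q.toU.D = Q.D := rfl
  rw [hD]
  congr 1
  funext j
  exact map_toU_levelTasks Q j

/-- Tasks of the typed schedule are tasks of the untyped one. [folklore] -/
theorem toU_mem_uagenda {τ : Task Q.D} (h : τ ∈ agenda Q) : τ.toU ∈ uagenda Q.toU := by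
  rw [← map_toU_agenda]; exact List.mem_map.2 ⟨τ, h, rfl⟩

/-- Binary-search tasks of a level are within the depth. [folklore] -/
theorem kLe_of_mem_ulevelTasks (P : UParams) (j : ℕ) {τ : UTask} (hτ : τ ∈ ulevelTasks P j) : τ.KLe P.L := by
  cases τ with
  | bs i k =>
    show k ≤ P.L
    unfold ulevelTasks at hτ
    simp only [List.mem_append, List.mem_ite_nil_left, List.mem_flatMap, List.mem_map, List.mem_range,
      List.mem_cons, List.not_mem_nil, or_false, reduceCtorEq, and_false, exists_false, or_self,
      UTask.bs.injEq] at hτ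
    obtain ⟨-, i', -, k', hk', -, rfl⟩ := hτ
    omega
  | _ => trivial

/-- Binary-search tasks of the schedule are within the depth. [folklore] -/
theorem kLe_of_mem_uagenda (P : UParams) {τ : UTask} (h : τ ∈ uagenda P) : τ.KLe P.L := by
  unfold uagenda at h
  obtain ⟨j, _, hj⟩ := List.mem_flatMap.1 h
  exact kLe_of_mem_ulevelTasks P j hj

end CommuteAgenda

end FKPointLocation

end Literature.Computability.Complexity
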